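/-
Copyright (c) 2026 the pub-hodgecm-mathlib formalisation cell (harness21).  Prover seat hodgecm-mathlib-LH10-p01 (g11), 2026-09-03.  Road M6 «ROW 2 ★ DYADIC TWIN» → F3
«TOT-Λ BY OVER-ORDERS» (LEAD F0P3a-plan T14-66 ∕ T15-08); F3-5 pen LH7-p04 (g12) DEAL «= GO (ζ1)» 00:55:55Z «EIGEN-UNIFORMISER COORDINATES + THE Θ̃-LINK» for
F3-5b-III (SIG-F3-5b-III v1 5a0aa3cf §1 rows `xR ∕ hxR ∕ cF ∕ hR`; source (c5-ii) SIG v1 §2 row 7, LH4-p01 (g10)).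
-/
import Mathlib.LinearAlgebra.Matrix.Trace
import Mathlib.LinearAlgebra.Matrix.Determinant.Basic
import Literature.NumberTheory.Automorphic.GluedOverOrderOfEisensteinPair   -- ★ (c6) FILE 1 (LH4-p01 (g10)) p853066: `exists_isUnit_mul_uniformizer_pow_eq`, the consumer `exists_coe_range_eval₂_eq_glued`; brings ★ `IsUniformizingElement` (`exists_eq_mul`, `valuation_lt_one`)
import HarnessLib

/-!
# Eisenstein coordinates of an eigen-uniformiser, and the Θ̃-link `λ = (u − a − b·p₀) + (−b·q₀)·θ`

Topic `NumberTheory/Automorphic`; namespace `Literature.NumberTheory.Automorphic`.  THEOREMS ONLY (no definition, no instance, no notation, no named fact, no `sorry`);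
kernel lane `--supports stmt-HodgeConjecture-24833`.  Cell `pub/hodgecm-mathlib` (D-0151), crux H413 = `stmt-HodgeConjecture-24833`; road M6 → F3 «TOT-Λ by over-orders»
(route (B)), brick F3-5b-III «the (W1) `hT` head at an inert place» (F3-5 pen LH7-p04 (g12), SIG-F3-5b-III v1): its §1 rows `xR ∕ hxR ∕ cF ∕ hR` feed ★ (c6)
`exists_coe_range_eval₂_eq_glued` (`GluedOverOrderOfEisensteinPair`) the type-(2) order's generator `(u, λ)` with `λ = jO p + jO q·θ` in ★ F3-1a's Eisenstein coordinates and
`v(q) = v(ϖ)^{N}`.  The (W1) Eisenstein block supplies instead `u•1 − g = a•1 + b•Θ` with `Θ = α•1 + β•g`, `v(det Θ) = v(ϖ)`, `v(tr Θ) < 1`, `v b = v(ϖ)^{N′}`; reading it on the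
root `λ` of `χ_g` in `K = E[θ]` gives `u − λ = a + b·Θ̃` with the EIGEN-UNIFORMISER `Θ̃ = α + β·λ`, a root of `X² − tr(Θ)X + det(Θ)`.  THIS FILE ((ζ1), (c5-ii) SIG v1 §2 row 7, LH4-p01
(g10)) proves: (ζ1a) such a `Θ̃` is INTEGRAL with Eisenstein coordinates `Θ̃ = jO p₀ + jO q₀·θ`, `q₀` a UNIT, `p₀ ∈ 𝔪`; (ζ1b) hence `λ = jO(u − a − b p₀) + jO(−b q₀)·θ` with
`v(−b q₀) = v(b)` — EXACTLY ★ (c6)'s `(p, q)` with `hN` read from `v b = v(ϖ)^{N′}`; (ζ1c) the 2×2 Cayley–Hamilton step `Θ̃² − tr(Θ)Θ̃ + det(Θ) = 0`.  Model-free, at the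
valued-field level `E ⊆ K` with ONE compatibility letter `hval : |x|_K ≤ 1 ↔ |x|_E ≤ 1` (`𝒪_K ∩ E = 𝒪_E`; at the place it is `|y|_K = |y|_E²`).
HONEST LABEL: HC_CM is proved only modulo the 7 printed citations (2 remaining named inputs: hLiu418 = stmt-HodgeConjecture-24832, h413 = stmt-HodgeConjecture-24833) until
rung 0 closes; elementary valuation algebra in a ramified quadratic algebra, asserts nothing printed; count-neutral (zero label movement until F5 ★ and a desk-priced rider).

FRAME.  `E ⊆ K` valued fields (`[ValuativeRel E] [ValuativeRel K] [Algebra E K]`), `hval`; ★ (c4)'s `jO : 𝒪[E] →+* 𝒪[K]`, `hjO`; ★ F3-1a ∕ F3-3's Eisenstein letters at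
`O₁ := 𝒪[K]`: `θ : 𝒪[K]`, `hθ : θ ^ 2 = jO a * θ + jO k` (★ (c6) ∕ F3-3 shape), `ha : a ∈ 𝔪`, `hϖ : IsUniformizingElement ϖ`, `hk₁ : v k = v ϖ`, `hcoord` (unique coordinates).

THE MATHEMATICS.  Under `hval`: `|x|_K < 1 ↔ |x|_E < 1` (invert), units of `𝒪_E` go to valuation-`1` elements, `𝔪_E = ϖ𝒪_E` goes below `|ϖ|_K`, and `|k|_K = |ϖ|_K` (`k = εϖ`).
Hence `|θ|_K < 1` (else `|θ²| = 1 > |aθ + k|`) and `|θ²|_K = |ϖ|_K` (`|aθ| < |a| ≤ |ϖ| = |k|`).  For a root `Θ̃` of `X² − tX + d`, `|t|_E < 1`, `|d|_E = |ϖ|`: `|Θ̃| ≤ 1` (else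
`|Θ̃²| > |tΘ̃ − d|`), `|Θ̃| < 1` (else `1 = |Θ̃²| > |tΘ̃ − d|`), `|Θ̃²| = |d| = |ϖ|` (`|tΘ̃| < |t| ≤ |ϖ|`), so `|ϖ| < |Θ̃| < 1`.  Write `Θ̃ = p₀ + q₀θ`: if `q₀ ∈ 𝔪` then `|q₀θ| ≤ |ϖ|`
and `|Θ̃|` is `1` (`p₀` a unit) or `≤ |ϖ|` (`p₀ ∈ 𝔪`) — both absurd; so `q₀` is a unit, and then `p₀ ∈ 𝔪` (else `|Θ̃| = 1`).  Finally `u − λ = a + bΘ̃` reads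
`λ = (u − a − b p₀) + (−b q₀)θ`, `|−b q₀| = |b|`; and `(α + βλ)² − tr(α•1 + β•g)(α + βλ) + det(α•1 + β•g) = β²(λ² − tr(g)λ + det g) = 0`.
[cite: SerreLocalFields1979, Ch. I §6 Prop. 17–18; Ch. II §2] [cite: Neukirch1999, Ch. II §4–§5, Ch. I §12] [cite: Rogawski1990, §4.9 Lemma 4.9.3 p. 56]

* §1 (transport under `hval`) `valuation_algebraMap_lt_one_iff`, `valuation_algebraMap_eq_one_iff`, `valuation_algebraMap_eq_one_of_isUnit`, `valuation_algebraMap_le_of_mem_maximalIdeal`,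
  `valuation_algebraMap_eq_of_valuation_eq_uniformizer`; (the uniformiser `θ`) `valuation_theta_lt_one`, `valuation_theta_sq_eq`.
* §2 (ζ1a) `mem_integer_of_eigenUniformiser`, `valuation_eigenUniformiser_lt_one`, `valuation_eigenUniformiser_sq_eq`, **`exists_coord_of_eigenUniformiser`**;
  (ζ1b) **`exists_coord_eigenvalue_of_rel`**; (ζ1c) `eigenUniformiser_isRoot_of_isRoot`.

## References
* [SerreLocalFields1979] J.-P. Serre, *Local Fields*, GTM 67 (1979): Ch. I §6 Prop. 17–18 (totally ramified extensions are generated by Eisenstein roots = uniformisers), Ch. II §2.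
* [Neukirch1999] J. Neukirch, *Algebraic Number Theory*, Grundlehren 322 (1999): Ch. II §4–§5 (valuations, `𝒪`, `𝔪 = (ϖ)`), Ch. I §12 (orders in a quadratic algebra).
* [Rogawski1990] J. D. Rogawski, *Automorphic Representations of Unitary Groups in Three Variables*, Ann. of Math. Stud. 123 (1990): §4.9 Lemma 4.9.3 p. 56 (where the type-(2)
  order `𝒪[γ]` enters the lattice count).
-/

set_option autoImplicit false

noncomputable section

open scoped ValuativeRel
open ValuativeRel

namespace Literature.NumberTheory.Automorphic

/-! ## §1 Transport of valuations `E → K` under `hval`, and the uniformiser `θ` -/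

section Transport

variable {E : Type*} [Field E] [ValuativeRel E] {K : Type*} [Field K] [ValuativeRel K] [Algebra E K]
  (hval : ∀ x : E, valuation K (algebraMap E K x) ≤ 1 ↔ valuation E x ≤ 1)

include hval in
/-- `|x|_K < 1 ↔ |x|_E < 1` (apply `hval` to `x⁻¹`). [cite: Neukirch1999, Ch. II §4] -/
theorem valuation_algebraMap_lt_one_iff (x : E) : valuation K (algebraMap E K x) < 1 ↔ valuation E x < 1 := by
  rcases eq_or_ne x 0 with rfl | hx
  · simp
  · have hK0 : valuation K (algebraMap E K x) ≠ 0 := (Valuation.ne_zero_iff _).2 ((map_ne_zero _).2 hx)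
    have hE0 : valuation E x ≠ 0 := (Valuation.ne_zero_iff _).2 hx
    have h := hval x⁻¹
    rw [map_inv₀, map_inv₀, map_inv₀, inv_le_one₀ (zero_lt_iff.2 hK0), inv_le_one₀ (zero_lt_iff.2 hE0)] at h
    constructor
    · intro hlt
      by_contra hge
      exact (lt_irrefl _) (lt_of_lt_of_le hlt (h.2 (not_lt.1 hge)))
    · intro hlt
      by_contra hge
      exact (lt_irrefl _) (lt_of_lt_of_le hlt (h.1 (not_lt.1 hge)))

include hval in
/-- `|x|_K = 1 ↔ |x|_E = 1`. [cite: Neukirch1999, Ch. II §4] -/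
theorem valuation_algebraMap_eq_one_iff (x : E) : valuation K (algebraMap E K x) = 1 ↔ valuation E x = 1 := by
  have h1 := hval x
  have h2 := valuation_algebraMap_lt_one_iff hval x
  constructor
  · intro h
    exact le_antisymm (h1.1 h.le) (not_lt.1 fun hlt => (lt_irrefl _) (h ▸ h2.2 hlt))
  · intro h
    exact le_antisymm (h1.2 h.le) (not_lt.1 fun hlt => (lt_irrefl _) (h ▸ h2.1 hlt))

include hval in
/-- A unit of `𝒪_E` has `|·|_K = 1`. [cite: Neukirch1999, Ch. II §4] -/
theorem valuation_algebraMap_eq_one_of_isUnit {r : 𝒪[E]} (hr : IsUnit r) : valuation K (algebraMap E K (r : E)) = 1 :=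
  (valuation_algebraMap_eq_one_iff hval (r : E)).2 ((Valuation.integer.integers (valuation E)).one_of_isUnit hr)

include hval in
/-- `𝔪_E = ϖ·𝒪_E` goes below `|ϖ|_K`: `r ∈ 𝔪 ⇒ |r|_K ≤ |ϖ|_K`. [cite: Neukirch1999, Ch. II §5] -/
theorem valuation_algebraMap_le_of_mem_maximalIdeal {ϖ : E} (hϖ : IsUniformizingElement ϖ) {r : 𝒪[E]} (hr : r ∈ IsLocalRing.maximalIdeal 𝒪[E]) :
    valuation K (algebraMap E K (r : E)) ≤ valuation K (algebraMap E K ϖ) := by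
  have hlt : valuation E (r : E) < 1 := by
    rw [IsLocalRing.mem_maximalIdeal, mem_nonunits_iff, (Valuation.integer.integers (valuation E)).isUnit_iff_valuation_eq_one] at hr
    exact lt_of_le_of_ne ((Valuation.mem_integer_iff _ _).1 r.2) hr
  obtain ⟨y, hy, hry⟩ := hϖ.exists_eq_mul r.2 hlt
  rw [hry, map_mul, map_mul]
  exact mul_le_of_le_one_right' ((hval y).2 ((Valuation.mem_integer_iff _ _).1 hy))

include hval in
/-- `|k|_E = |ϖ|_E ⇒ |k|_K = |ϖ|_K` (`k = εϖ`, `ε` a unit — ★ (c6) `exists_isUnit_mul_uniformizer_pow_eq` at `N = 1`). [cite: Neukirch1999, Ch. II §5] -/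
theorem valuation_algebraMap_eq_of_valuation_eq_uniformizer {ϖ : E} (hϖ : IsUniformizingElement ϖ) {k : 𝒪[E]}
    (hk₁ : valuation E (k : E) = valuation E ϖ) : valuation K (algebraMap E K (k : E)) = valuation K (algebraMap E K ϖ) := by
  obtain ⟨ε, hεu, hk⟩ := exists_isUnit_mul_uniformizer_pow_eq hϖ (q := k) (N := 1) (by rw [pow_one]; exact hk₁)
  rw [hk, Subring.coe_mul, SubmonoidClass.coe_pow, pow_one, map_mul, map_mul, valuation_algebraMap_eq_one_of_isUnit hval hεu, one_mul]

variable (jO : 𝒪[E] →+* 𝒪[K]) (hjO : ∀ x : 𝒪[E], ((jO x : 𝒪[K]) : K) = algebraMap E K x)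
  (θ : 𝒪[K]) {a k : 𝒪[E]} (hθ : θ ^ 2 = jO a * θ + jO k) (ha : a ∈ IsLocalRing.maximalIdeal 𝒪[E])
  {ϖ : E} (hϖ : IsUniformizingElement ϖ) (hk₁ : valuation E (k : E) = valuation E ϖ)

include hval hjO hθ ha hϖ hk₁ in
/-- **`θ` LIES IN `𝔪_K`**: `|θ|_K < 1` (else `|θ²| = 1 > |aθ + k|`, `a, k ∈ 𝔪`). [cite: SerreLocalFields1979, Ch. I §6 Prop. 17] -/
theorem valuation_theta_lt_one : valuation K (θ : K) < 1 := by
  have hθ1 : valuation K (θ : K) ≤ 1 := (Valuation.mem_integer_iff _ _).1 θ.2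
  have hϖ1 : valuation K (algebraMap E K ϖ) < 1 := (valuation_algebraMap_lt_one_iff hval ϖ).2 hϖ.valuation_lt_one
  have haK : valuation K (algebraMap E K (a : E)) < 1 := lt_of_le_of_lt (valuation_algebraMap_le_of_mem_maximalIdeal hval hϖ ha) hϖ1
  have hkK : valuation K (algebraMap E K (k : E)) < 1 := by rw [valuation_algebraMap_eq_of_valuation_eq_uniformizer hval hϖ hk₁]; exact hϖ1
  refine lt_of_le_of_ne hθ1 fun h1 => ?_
  have hθK : ((θ ^ 2 : 𝒪[K]) : K) = algebraMap E K (a : E) * (θ : K) + algebraMap E K (k : E) := by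
    rw [hθ, Subring.coe_add, Subring.coe_mul, hjO, hjO]
  have hlhs : valuation K ((θ ^ 2 : 𝒪[K]) : K) = 1 := by rw [SubmonoidClass.coe_pow, map_pow, h1, one_pow]
  have hrhs : valuation K (algebraMap E K (a : E) * (θ : K) + algebraMap E K (k : E)) < 1 := by
    refine lt_of_le_of_lt (Valuation.map_add _ _ _) (max_lt ?_ hkK)
    rw [map_mul, h1, mul_one]; exact haK
  rw [hθK] at hlhs
  exact (lt_irrefl _) (hlhs ▸ hrhs)

include hval hjO hθ ha hϖ hk₁ in
/-- **`|θ²|_K = |ϖ|_K`** (`|aθ| < |a| ≤ |ϖ| = |k|`): `θ` is a uniformiser of the ramified quadratic algebra `K = E[θ]`, in EVERY row (`a = 0` or not). [cite: SerreLocalFields1979, Ch. I §6 Prop. 17–18] -/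
theorem valuation_theta_sq_eq : valuation K ((θ : K) ^ 2) = valuation K (algebraMap E K ϖ) := by
  have hkK := valuation_algebraMap_eq_of_valuation_eq_uniformizer hval hϖ hk₁ (K := K)
  have hθ1 := valuation_theta_lt_one hval jO hjO θ hθ ha hϖ hk₁
  have haϖ : valuation K (algebraMap E K (a : E)) ≤ valuation K (algebraMap E K (k : E)) := by
    rw [hkK]; exact valuation_algebraMap_le_of_mem_maximalIdeal hval hϖ ha
  -- `|aθ| < |k|`
  have haθ : valuation K (algebraMap E K (a : E) * (θ : K)) < valuation K (algebraMap E K (k : E)) := by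
    rw [map_mul]
    rcases eq_or_ne (valuation K (algebraMap E K (a : E))) 0 with h0 | h0
    · rw [h0, zero_mul, hkK]
      exact zero_lt_iff.2 ((Valuation.ne_zero_iff _).2 ((map_ne_zero _).2 hϖ.ne_zero))
    · have h := mul_lt_mul_of_pos_left hθ1 (zero_lt_iff.2 h0)
      rw [mul_one] at h
      exact lt_of_lt_of_le h haϖ
  have hθK : ((θ : K) ^ 2) = algebraMap E K (a : E) * (θ : K) + algebraMap E K (k : E) := by
    have h := congrArg (fun z : 𝒪[K] => (z : K)) hθ
    simpa only [SubmonoidClass.coe_pow, Subring.coe_add, Subring.coe_mul, hjO] using h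
  rw [hθK, Valuation.map_add_eq_of_lt_right _ haθ, hkK]

end Transport

/-! ## §2 The eigen-uniformiser `Θ̃`: integrality, Eisenstein coordinates, the Θ̃-link -/

section EigenUniformiser

variable {E : Type*} [Field E] [ValuativeRel E] {K : Type*} [Field K] [ValuativeRel K] [Algebra E K]
  (hval : ∀ x : E, valuation K (algebraMap E K x) ≤ 1 ↔ valuation E x ≤ 1)
  {ϖ : E} (hϖ : IsUniformizingElement ϖ)
  {Θt : K} {tΘ dΘ : 𝒪[E]} (hΘt : Θt ^ 2 - algebraMap E K (tΘ : E) * Θt + algebraMap E K (dΘ : E) = 0)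
  (htΘ : valuation E (tΘ : E) < 1) (hdΘ : valuation E (dΘ : E) = valuation E ϖ)

include hval hΘt in
/-- **`Θ̃` IS INTEGRAL**: a root of `X² − tX + d` with `t, d ∈ 𝒪_E` lies in `𝒪_K` (if `|Θ̃| > 1` then `|Θ̃²| > |tΘ̃ − d|`). [cite: Neukirch1999, Ch. II §4] -/
theorem mem_integer_of_eigenUniformiser : Θt ∈ 𝒪[K] := by
  rw [Valuation.mem_integer_iff]
  by_contra hgt
  rw [not_le] at hgt
  have hpos : 0 < valuation K Θt := lt_trans zero_lt_one hgt
  have heq : Θt ^ 2 = algebraMap E K (tΘ : E) * Θt - algebraMap E K (dΘ : E) := by linear_combination hΘt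
  have ht1 : valuation K (algebraMap E K (tΘ : E)) ≤ 1 := (hval _).2 ((Valuation.mem_integer_iff _ _).1 tΘ.2)
  have hd1 : valuation K (algebraMap E K (dΘ : E)) ≤ 1 := (hval _).2 ((Valuation.mem_integer_iff _ _).1 dΘ.2)
  have hrhs : valuation K (algebraMap E K (tΘ : E) * Θt - algebraMap E K (dΘ : E)) ≤ valuation K Θt := by
    refine le_trans (Valuation.map_sub _ _ _) (max_le ?_ (le_trans hd1 hgt.le))
    rw [map_mul]
    exact mul_le_of_le_one_left' ht1
  have hlhs : valuation K Θt < valuation K (Θt ^ 2) := by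
    have h := mul_lt_mul_of_pos_left hgt hpos
    rwa [mul_one, ← pow_two, ← map_pow] at h
  rw [heq] at hlhs
  exact (lt_irrefl _) (lt_of_lt_of_le hlhs hrhs)

include hval hϖ hΘt htΘ hdΘ in
/-- **`|Θ̃| < 1`** (if `|Θ̃| = 1` then `1 = |Θ̃²| > |tΘ̃ − d|`, as `|t|, |d| < 1`). [cite: SerreLocalFields1979, Ch. I §6 Prop. 17] -/
theorem valuation_eigenUniformiser_lt_one : valuation K Θt < 1 := by
  have hΘ1 : valuation K Θt ≤ 1 := (Valuation.mem_integer_iff _ _).1 (mem_integer_of_eigenUniformiser hval hΘt)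
  have hϖ1 : valuation K (algebraMap E K ϖ) < 1 := (valuation_algebraMap_lt_one_iff hval ϖ).2 hϖ.valuation_lt_one
  have ht1 : valuation K (algebraMap E K (tΘ : E)) < 1 := (valuation_algebraMap_lt_one_iff hval _).2 htΘ
  have hd1 : valuation K (algebraMap E K (dΘ : E)) < 1 := by rw [valuation_algebraMap_eq_of_valuation_eq_uniformizer hval hϖ hdΘ]; exact hϖ1
  refine lt_of_le_of_ne hΘ1 fun h1 => ?_
  have heq : Θt ^ 2 = algebraMap E K (tΘ : E) * Θt - algebraMap E K (dΘ : E) := by linear_combination hΘt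
  have hlhs : valuation K (Θt ^ 2) = 1 := by rw [map_pow, h1, one_pow]
  have hrhs : valuation K (algebraMap E K (tΘ : E) * Θt - algebraMap E K (dΘ : E)) < 1 := by
    refine lt_of_le_of_lt (Valuation.map_sub _ _ _) (max_lt ?_ hd1)
    rw [map_mul, h1, mul_one]; exact ht1
  rw [heq] at hlhs
  exact (lt_irrefl _) (hlhs ▸ hrhs)

include hval hϖ hΘt htΘ hdΘ in
/-- **`|Θ̃²| = |ϖ|`** (`|tΘ̃| < |t| ≤ |ϖ| = |d|`): `Θ̃` is a UNIFORMISER of `K`. [cite: SerreLocalFields1979, Ch. I §6 Prop. 17–18] -/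
theorem valuation_eigenUniformiser_sq_eq : valuation K (Θt ^ 2) = valuation K (algebraMap E K ϖ) := by
  have hΘ1 := valuation_eigenUniformiser_lt_one hval hϖ hΘt htΘ hdΘ
  have hdK : valuation K (algebraMap E K (dΘ : E)) = valuation K (algebraMap E K ϖ) := valuation_algebraMap_eq_of_valuation_eq_uniformizer hval hϖ hdΘ
  have htm : tΘ ∈ IsLocalRing.maximalIdeal 𝒪[E] := by
    rw [IsLocalRing.mem_maximalIdeal, mem_nonunits_iff, (Valuation.integer.integers (valuation E)).isUnit_iff_valuation_eq_one]
    exact htΘ.ne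
  have htd : valuation K (algebraMap E K (tΘ : E)) ≤ valuation K (algebraMap E K (dΘ : E)) := by
    rw [hdK]; exact valuation_algebraMap_le_of_mem_maximalIdeal hval hϖ htm
  have htΘd : valuation K (algebraMap E K (tΘ : E) * Θt) < valuation K (-(algebraMap E K (dΘ : E))) := by
    rw [Valuation.map_neg, map_mul]
    rcases eq_or_ne (valuation K (algebraMap E K (tΘ : E))) 0 with h0 | h0
    · rw [h0, zero_mul, hdK]
      exact zero_lt_iff.2 ((Valuation.ne_zero_iff _).2 ((map_ne_zero _).2 hϖ.ne_zero))
    · have h := mul_lt_mul_of_pos_left hΘ1 (zero_lt_iff.2 h0)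
      rw [mul_one] at h
      exact lt_of_lt_of_le h htd
  have heq : Θt ^ 2 = -(algebraMap E K (dΘ : E)) + algebraMap E K (tΘ : E) * Θt := by linear_combination hΘt
  rw [heq, Valuation.map_add_eq_of_lt_left _ htΘd, Valuation.map_neg, hdK]

variable (jO : 𝒪[E] →+* 𝒪[K]) (hjO : ∀ x : 𝒪[E], ((jO x : 𝒪[K]) : K) = algebraMap E K x)
  (θ : 𝒪[K]) {a k : 𝒪[E]} (hθ : θ ^ 2 = jO a * θ + jO k) (ha : a ∈ IsLocalRing.maximalIdeal 𝒪[E])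
  (hk₁ : valuation E (k : E) = valuation E ϖ)
  (hcoord : ∀ z : 𝒪[K], ∃! bc : 𝒪[E] × 𝒪[E], z = jO bc.1 + jO bc.2 * θ)

include hval hϖ hΘt htΘ hdΘ hjO hθ ha hk₁ hcoord in
/-- **(ζ1a) EISENSTEIN COORDINATES OF THE EIGEN-UNIFORMISER**: a root `Θ̃ ∈ K` of `X² − tX + d` with `|t|_E < 1`, `|d|_E = |ϖ|` is integral, and its coordinates on ★ F3-1a's
basis `(1, θ)` of `𝒪_K` are `Θ̃ = jO p₀ + jO q₀·θ` with `q₀` a UNIT and `p₀ ∈ 𝔪` — because `|ϖ| < |Θ̃| < 1` while `|p₀ + q₀θ|` would be `1` or `≤ |ϖ|` otherwise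
(`|θ| < 1`, `|θ²| = |ϖ|`).  Source: (c5-ii) SIG v1 §2 row 7 (LH4-p01 (g10)). [cite: SerreLocalFields1979, Ch. I §6 Prop. 17–18] [cite: Neukirch1999, Ch. I §12, Ch. II §5] -/
theorem exists_coord_of_eigenUniformiser :
    ∃ (hΘO : Θt ∈ 𝒪[K]) (p₀ q₀ : 𝒪[E]), (⟨Θt, hΘO⟩ : 𝒪[K]) = jO p₀ + jO q₀ * θ ∧ IsUnit q₀ ∧ p₀ ∈ IsLocalRing.maximalIdeal 𝒪[E] := by
  have hΘO : Θt ∈ 𝒪[K] := mem_integer_of_eigenUniformiser hval hΘt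
  obtain ⟨⟨p₀, q₀⟩, hpq, -⟩ := hcoord ⟨Θt, hΘO⟩
  refine ⟨hΘO, p₀, q₀, hpq, ?_⟩
  -- valuations in play
  have hV1 : valuation K Θt < 1 := valuation_eigenUniformiser_lt_one hval hϖ hΘt htΘ hdΘ
  have hsq : valuation K (Θt ^ 2) = valuation K (algebraMap E K ϖ) := valuation_eigenUniformiser_sq_eq hval hϖ hΘt htΘ hdΘ
  have hϖ0 : valuation K (algebraMap E K ϖ) ≠ 0 := (Valuation.ne_zero_iff _).2 ((map_ne_zero _).2 hϖ.ne_zero)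
  have hϖ1 : valuation K (algebraMap E K ϖ) < 1 := (valuation_algebraMap_lt_one_iff hval ϖ).2 hϖ.valuation_lt_one
  have hVpos : 0 < valuation K Θt := by
    refine zero_lt_iff.2 fun h0 => hϖ0 ?_
    rw [← hsq, map_pow, h0, zero_pow two_ne_zero]
  have hϖV : valuation K (algebraMap E K ϖ) < valuation K Θt := by
    have h := mul_lt_mul_of_pos_left hV1 hVpos
    rwa [mul_one, ← pow_two, ← map_pow, hsq] at h
  have hθ1 : valuation K (θ : K) < 1 := valuation_theta_lt_one hval jO hjO θ hθ ha hϖ hk₁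
  -- `Θ̃ = p₀ + q₀θ` in `K`
  have hΘK : Θt = algebraMap E K (p₀ : E) + algebraMap E K (q₀ : E) * (θ : K) := by
    have h := congrArg (fun z : 𝒪[K] => (z : K)) hpq
    simpa only [Subring.coe_add, Subring.coe_mul, hjO] using h
  -- a member of `𝔪_E` times `θ` is below `|ϖ|`
  have hsmall : ∀ r : 𝒪[E], r ∈ IsLocalRing.maximalIdeal 𝒪[E] → valuation K (algebraMap E K (r : E) * (θ : K)) ≤ valuation K (algebraMap E K ϖ) := by
    intro r hr
    rw [map_mul]
    exact le_trans (mul_le_of_le_one_right' hθ1.le) (valuation_algebraMap_le_of_mem_maximalIdeal hval hϖ hr)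
  have hunit : ∀ r : 𝒪[E], r ∉ IsLocalRing.maximalIdeal 𝒪[E] → valuation K (algebraMap E K (r : E)) = 1 := by
    intro r hr
    rw [IsLocalRing.mem_maximalIdeal, mem_nonunits_iff, not_not] at hr
    exact valuation_algebraMap_eq_one_of_isUnit hval hr
  -- `q₀` is a unit
  have hq₀ : IsUnit q₀ := by
    by_contra hq
    have hqm : q₀ ∈ IsLocalRing.maximalIdeal 𝒪[E] := (IsLocalRing.mem_maximalIdeal _).2 (mem_nonunits_iff.2 hq)
    have hqθ := hsmall q₀ hqm
    by_cases hp : p₀ ∈ IsLocalRing.maximalIdeal 𝒪[E]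
    · -- `|Θ̃| ≤ |ϖ| < |Θ̃|`
      have hle : valuation K Θt ≤ valuation K (algebraMap E K ϖ) := by
        rw [hΘK]
        exact le_trans (Valuation.map_add _ _ _) (max_le (valuation_algebraMap_le_of_mem_maximalIdeal hval hϖ hp) hqθ)
      exact (lt_irrefl _) (lt_of_le_of_lt hle hϖV)
    · -- `|Θ̃| = 1`
      have hp1 := hunit p₀ hp
      have hlt : valuation K (algebraMap E K (q₀ : E) * (θ : K)) < valuation K (algebraMap E K (p₀ : E)) := by
        rw [hp1]; exact lt_of_le_of_lt hqθ hϖ1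
      have h1 : valuation K Θt = 1 := by rw [hΘK, Valuation.map_add_eq_of_lt_left _ hlt, hp1]
      exact (lt_irrefl _) (h1 ▸ hV1)
  refine ⟨hq₀, ?_⟩
  -- `p₀ ∈ 𝔪`
  by_contra hp
  have hp1 := hunit p₀ hp
  have hq1 : valuation K (algebraMap E K (q₀ : E)) = 1 := valuation_algebraMap_eq_one_of_isUnit hval hq₀
  have hlt : valuation K (algebraMap E K (q₀ : E) * (θ : K)) < valuation K (algebraMap E K (p₀ : E)) := by
    rw [map_mul, hq1, one_mul, hp1]; exact hθ1
  have h1 : valuation K Θt = 1 := by rw [hΘK, Valuation.map_add_eq_of_lt_left _ hlt, hp1]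
  exact (lt_irrefl _) (h1 ▸ hV1)

end EigenUniformiser

/-! ### (ζ1b) The Θ̃-link: `λ` in Eisenstein coordinates -/

section Link

variable {E : Type*} [Field E] [ValuativeRel E] {K : Type*} [Field K] [ValuativeRel K] [Algebra E K]
  (jO : 𝒪[E] →+* 𝒪[K]) (hjO : ∀ x : 𝒪[E], ((jO x : 𝒪[K]) : K) = algebraMap E K x) (θ : 𝒪[K])

include hjO in
/-- **(ζ1b) THE Θ̃-LINK**: if `u − λ = a + b·Θ̃` (the (W1) relation `u•1 − g = a•1 + b•Θ` read on the root `λ` of `χ_g`, `Θ̃ = α + βλ`) and `Θ̃ = jO p₀ + jO q₀·θ` with `q₀` a unit,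
then `λ` is integral with Eisenstein coordinates `λ = jO(u − a − b·p₀) + jO(−(b·q₀))·θ` and `|−b·q₀| = |b|` — EXACTLY ★ (c6) `exists_coe_range_eval₂_eq_glued`'s `(p, q)`, its
`hN : |q| = |ϖ|^N` being (W1)'s `|b| = |ϖ|^{N′}`. [cite: Neukirch1999, Ch. I §12] [cite: Rogawski1990, §4.9 Lemma 4.9.3 p. 56] -/
theorem exists_coord_eigenvalue_of_rel {Θt : K} (hΘO : Θt ∈ 𝒪[K]) {p₀ q₀ : 𝒪[E]} (hΘ : (⟨Θt, hΘO⟩ : 𝒪[K]) = jO p₀ + jO q₀ * θ) (hq₀ : IsUnit q₀)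
    {lam : K} {u a b : 𝒪[E]} (hrel : algebraMap E K (u : E) - lam = algebraMap E K (a : E) + algebraMap E K (b : E) * Θt) :
    ∃ hlamO : lam ∈ 𝒪[K], (⟨lam, hlamO⟩ : 𝒪[K]) = jO (u - a - b * p₀) + jO (-(b * q₀)) * θ ∧
      valuation E ((-(b * q₀) : 𝒪[E]) : E) = valuation E (b : E) := by
  set z : 𝒪[K] := jO (u - a - b * p₀) + jO (-(b * q₀)) * θ with hz
  have hΘK : Θt = algebraMap E K (p₀ : E) + algebraMap E K (q₀ : E) * (θ : K) := by
    have h := congrArg (fun z : 𝒪[K] => (z : K)) hΘ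
    simpa only [Subring.coe_add, Subring.coe_mul, hjO] using h
  have hzK : (z : K) = lam := by
    rw [hz]
    simp only [Subring.coe_add, Subring.coe_mul, AddSubgroupClass.coe_sub, NegMemClass.coe_neg, map_sub, map_mul, map_neg, hjO]
    linear_combination hrel + algebraMap E K (b : E) * hΘK
  refine ⟨hzK ▸ z.2, Subtype.ext hzK.symm, ?_⟩
  have hq1 : valuation E (q₀ : E) = 1 := (Valuation.integer.integers (valuation E)).one_of_isUnit hq₀
  simp only [NegMemClass.coe_neg, Subring.coe_mul, Valuation.map_neg, map_mul, hq1, mul_one]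

end Link

/-! ### (ζ1c) The 2×2 Cayley–Hamilton step for `Θ̃ = α + βλ` -/

section CayleyHamilton

/-- **(ζ1c)** For a root `λ` of `χ_g = X² − tr(g)X + det(g)` (`g` a 2×2 matrix over `R`, `λ` in an `R`-algebra `S`) and scalars `α, β`, the element `Θ̃ = α + βλ` is a root of
`X² − tr(Θ)X + det(Θ)` for `Θ = α•1 + β•g` (`tr Θ = 2α + β·tr g`, `det Θ = α² + αβ·tr g + β²·det g`). [cite: Neukirch1999, Ch. I §12] [cite: Rogawski1990, §4.9 Lemma 4.9.3 p. 56] -/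
theorem eigenUniformiser_isRoot_of_isRoot {R S : Type*} [CommRing R] [CommRing S] [Algebra R S] (g : Matrix (Fin 2) (Fin 2) R) {lam : S}
    (hlam : lam ^ 2 - algebraMap R S g.trace * lam + algebraMap R S g.det = 0) (α β : R) :
    (algebraMap R S α + algebraMap R S β * lam) ^ 2 -
        algebraMap R S (α • (1 : Matrix (Fin 2) (Fin 2) R) + β • g).trace * (algebraMap R S α + algebraMap R S β * lam) +
      algebraMap R S (α • (1 : Matrix (Fin 2) (Fin 2) R) + β • g).det = 0 := by
  have h01 : (1 : Matrix (Fin 2) (Fin 2) R) 0 1 = 0 := Matrix.one_apply_ne (by decide)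
  have h10 : (1 : Matrix (Fin 2) (Fin 2) R) 1 0 = 0 := Matrix.one_apply_ne (by decide)
  have htr : (α • (1 : Matrix (Fin 2) (Fin 2) R) + β • g).trace = 2 * α + β * g.trace := by
    rw [Matrix.trace_fin_two, Matrix.trace_fin_two]
    simp only [Matrix.add_apply, Matrix.smul_apply, Matrix.one_apply_eq, smul_eq_mul, mul_one]
    ring
  have hdet : (α • (1 : Matrix (Fin 2) (Fin 2) R) + β • g).det = α ^ 2 + α * β * g.trace + β ^ 2 * g.det := by
    rw [Matrix.det_fin_two, Matrix.trace_fin_two, Matrix.det_fin_two]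
    simp only [Matrix.add_apply, Matrix.smul_apply, Matrix.one_apply_eq, h01, h10, smul_eq_mul, mul_one, mul_zero, zero_add]
    ring
  rw [htr, hdet]
  simp only [map_add, map_mul, map_pow, map_ofNat]
  linear_combination (algebraMap R S β) ^ 2 * hlam

end CayleyHamilton

end Literature.NumberTheory.Automorphic

end
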